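import Summits.QuantumFields.BalabanUV.Beta.D1BFx.RJetAssembly

/-!
# `BalabanUV.Beta.D1BFx.RJetProjector` — road «BF-x» for binder row D1, sub-leaf J5-asm part 2: THE ROAD INSTANCE of the bond-level
# gauge-term jet over J5.0's projector — `R := 1 − Pgt n a`, the block-sup ⇒ fine-`ℓ¹` decay conversion, the BLOCK COVARIANCE of
# `Pgt` (via «the operator C» being translation-invariant), `Rjet n a Ṙ := RjetOf (Rgt n a) Ṙ` and its sockets modulo the site jet `Ṙ`

HONEST DEPENDENCY (page 1, mandatory): continuum YM on T⁴ ⇐ BetaPertH ∧ nine spine estimates (0/9 proved); BetaPertH ⇐ (D1) ∧ (D4) ∧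
CAP+tail; G-an2-4 gates asym, D1 and NE2/3/4.  HONEST FRAMING (cell contract, verbatim): «discharging `BetaPertH` makes Bałaban's UV
stability UNCONDITIONAL — a real constructive-QFT result; it is NOT the continuum limit and NOT the Clay problem.»  THIS MODULE
DISCHARGES NOTHING: [folklore] lattice bookkeeping (block coordinates, exponential weights, re-indexed absolutely convergent series and
the uniqueness of the bounded inverse kernel on `ℤ⁴`) composed BY NAME from LANDED modules — J5.0 `D1BFx/RProjector(Range)` (leaf-09-g2:
`Pgt`, `abs_Pgt_le`, `Pgt_symm`, `kerP`, `Pker`, `tsum_kerSq_mul_Csq`), pv23's `B6QGGQ278Zd` (`kerSq`, `Csq`, `abs_Csq_le`, `hyp56Z_KerSq`) and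
`B4Sect5Exhaustion.eq_limInv_of_right_inverse`, `B5Hk103ScalarZd` (`gq`, `toK`), the typer's `D1BFx/GhostLeg` (`Gk_translate`, `blk_translate`,
`side_pred`, `l1_sub_le_four_mul_dist`) and part 1 `D1BFx/RJetAssembly` (`RjetOf` + sockets).  Two data defs (`Rgt`, `Rjet`, bodies); no `Prop` is
minted; nothing printed is asserted; 0 sorry.  Road BF-x scaffolding; 0 wall binders.  NOT D1, NOT `BetaPertH`, NOT continuum, NOT Clay.
ABSOLUTE RULE (cell charter, verbatim): «No internally-minted statement may enter as a cited fact. Every hypothesis is either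
kernel-proved in this package or a verbatim quotation of a PUBLISHED theorem with page reference. The manuscript(s) under audit are NOT
citable for their own disputed steps — they are the thing under adjudication; programme-internal (2001/route/tribunal) claims are never
citable.»

CONTENT (`d = 4`; block side `n` in the road's currency = `side (n − 1)` of the `B6QGQLower276` bookkeeping).
* §1 `abs_sub_le_side_mul`, **`dist_le_side_mul_dist_blk`** (`dist x y ≤ (m+1)·dist (blk m x) (blk m y) + m` on `ℤ⁴`), **`decays_of_blkBound`**
  (a `Unit`-fibred kernel bounded by `C·e^{−δ·dist(blk_m x, blk_m y)}`, `C, δ ≥ 0`, satisfies `Decays K (C·e^{δ}) (δ/(4(m+1)))`), `decays_mono_rate`.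
* §2 **`decays_Pgt`** (`Decays (Pgt n a) (c_PP e^{δ_PP}) (δ_PP/(4n))` from J5.0's `abs_Pgt_le`), [our object] **`Rgt n a := 1 − Pgt n a`** (`Rgt_symm`,
  `decays_Rgt` with constant `1 + c_PP e^{δ_PP}`), `shiftK_Rgt_of_Pgt`, [our object] **`Rjet n a Ṙ κ′ u := RjetOf (Rgt n a) Ṙ κ′ u`** and its sockets
  modulo the site jet: **`biLoc_Rjet`** (`BiLoc (Ṙ κ′ u) u u C′ δ`, `0 ≤ δ ≤ δ_PP/(4n)` ⇒ `BiLoc (Rjet n a Ṙ κ′ u) u u (4(1 + c_PP e^{δ_PP} + C′)e^{2δ}) δ`),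
  **`Rjet_antisymm`** (antisymmetric `Ṙ` ⇒ antisymmetric `Rjet`), `Rjet_translate_of` (covariance GIVEN `shiftK (n•t) (Pgt n a) = Pgt n a`).
* §3 THE HYPOTHESIS DISCHARGED: `mem_B_add_iff`, **`gq_translate`** (`G′Q′*`), **`kerSq_translate`** (`Q′G′²Q′*`), **`Csq_translate`** («the operator C» —
  the translated kernel is again a bounded inverse of the translation-invariant `Q′G′²Q′*`; uniqueness `eq_limInv_of_right_inverse`, the pattern of
  `GhostLeg.Gk_translate`), `kerP_translate`, **`Pker_translate`**, **`shiftK_Pgt : shiftK (n•t) (Pgt n a) = Pgt n a`**, `shiftK_Rgt`, and the unconditional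
  **`Rjet_translate`**: `Ṙ κ′ (u + n•t) = shiftK (−n•t) (Ṙ κ′ u)` ⇒ `Rjet n a Ṙ κ′ (u + n•t) = shiftK (−n•t) (Rjet n a Ṙ κ′ u)`.
WHAT IT GIVES THE ROAD: T4's summand `cR • Rjet n a (Ṙ n a) κ′ u` has its `locStencil` (rate `δ/n` class), transposition and (St♭) sockets the moment the
J5-kernel site jet `Ṙ n a` (leaf-07-g2) lands with `BiLoc`/antisymmetry/block covariance.  NOT HERE: `Ṙ` itself, colour weights, `cR`, T4/T5, any estimate
uniform in `n` beyond the displayed constants (note `c_PP` is `n`-independent by J5.0's definition; the rate `δ_PP/(4n)` is the block-structured class).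
Unit `b2b-balaban-beta-d1-formalise-leaf-05` (gen 3), D1 formalisation swarm; `LEAVES-BFx.md` sub-row J5-asm.
-/

namespace Summit.QuantumFields.BalabanUV.Beta.D1BFx.RJetProjector

open Literature.MathematicalPhysics.QuantumFieldTheory.Balaban1983to89
open Literature.MathematicalPhysics.QuantumFieldTheory.Balaban1983to89.Beta
open B12Sec2to5 (l1 l1_nonneg)
open ExpKernelCalculus (Site MKer BiLoc Decays shiftK)
open AffineAveraging (unitVec)
open B6QGQLower276 (X side blk loc side_facts side_mul_blk_add_loc loc_nonneg loc_lt)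
open GhostLeg (l1_sub_le_four_mul_dist cast_pred_add_one)
open RProjector (Pgt Pgt_apply Pgt_symm abs_Pgt_le cPP deltaPP cPP_nonneg deltaPP_pos)
open RJetAssembly (RjetOf RjetOf_apply RjetOf_antisymm RjetOf_translate biLoc_RjetOf)

noncomputable section

/-! ## §1 Block-sup decay ⇒ fine `ℓ¹` decay -/

/-- [folklore] One coordinate: `|x_μ − y_μ| ≤ (m+1)·|blk x_μ − blk y_μ| + m` (the local coordinates differ by at most `m`). -/
theorem abs_sub_le_side_mul (m : ℕ) (x y : X 4) (μ : Fin 4) :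
    |((x μ : ℤ) : ℝ) - (y μ : ℤ)| ≤ ((m : ℝ) + 1) * |((blk m x μ : ℤ) : ℝ) - (blk m y μ : ℤ)| + m := by
  have hx := side_mul_blk_add_loc m x μ
  have hy := side_mul_blk_add_loc m y μ
  have l0x := loc_nonneg m x μ; have l0y := loc_nonneg m y μ
  have l1x := loc_lt m x μ; have l1y := loc_lt m y μ
  have hs : (side m : ℤ) = (m : ℤ) + 1 := rfl
  have ex : ((x μ : ℤ) : ℝ) = ((m : ℝ) + 1) * (blk m x μ : ℤ) + (loc m x μ : ℤ) := by
    rw [← hx, hs]; push_cast; ring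
  have ey : ((y μ : ℤ) : ℝ) = ((m : ℝ) + 1) * (blk m y μ : ℤ) + (loc m y μ : ℤ) := by
    rw [← hy, hs]; push_cast; ring
  have hl : |((loc m x μ : ℤ) : ℝ) - (loc m y μ : ℤ)| ≤ m := by
    rw [hs] at l1x l1y
    rw [abs_le]
    constructor
    · have : ((loc m y μ : ℤ) : ℝ) ≤ m := by exact_mod_cast (by omega : loc m y μ ≤ m)
      have : (0 : ℝ) ≤ ((loc m x μ : ℤ) : ℝ) := by exact_mod_cast l0x
      linarith
    · have : ((loc m x μ : ℤ) : ℝ) ≤ m := by exact_mod_cast (by omega : loc m x μ ≤ m)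
      have : (0 : ℝ) ≤ ((loc m y μ : ℤ) : ℝ) := by exact_mod_cast l0y
      linarith
  rw [ex, ey]
  have hm : (0 : ℝ) ≤ (m : ℝ) + 1 := by positivity
  calc |((m : ℝ) + 1) * (blk m x μ : ℤ) + (loc m x μ : ℤ) - (((m : ℝ) + 1) * (blk m y μ : ℤ) + (loc m y μ : ℤ))|
      = |((m : ℝ) + 1) * (((blk m x μ : ℤ) : ℝ) - (blk m y μ : ℤ)) + (((loc m x μ : ℤ) : ℝ) - (loc m y μ : ℤ))| := by ring_nf
    _ ≤ |((m : ℝ) + 1) * (((blk m x μ : ℤ) : ℝ) - (blk m y μ : ℤ))| + |((loc m x μ : ℤ) : ℝ) - (loc m y μ : ℤ)| := abs_add_le _ _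
    _ ≤ ((m : ℝ) + 1) * |((blk m x μ : ℤ) : ℝ) - (blk m y μ : ℤ)| + m := by rw [abs_mul, abs_of_nonneg hm]; linarith

/-- [folklore] **FINE SUP-DISTANCE VS BLOCK SUP-DISTANCE**: `dist x y ≤ (m+1)·dist (blk m x) (blk m y) + m` on `ℤ⁴` (blocks of side `m+1`). -/
theorem dist_le_side_mul_dist_blk (m : ℕ) (x y : X 4) : dist x y ≤ ((m : ℝ) + 1) * dist (blk m x) (blk m y) + m := by
  refine (dist_pi_le_iff (by positivity)).2 fun μ => ?_
  rw [Int.dist_eq]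
  refine (abs_sub_le_side_mul m x y μ).trans ?_
  have h := dist_le_pi_dist (blk m x) (blk m y) μ
  rw [Int.dist_eq] at h
  have hm : (0 : ℝ) ≤ (m : ℝ) + 1 := by positivity
  nlinarith

/-- [folklore] **BLOCK-SUP DECAY ⇒ FINE `ℓ¹` DECAY**: a `Unit`-fibred kernel bounded by `C·e^{−δ·dist(blk_m x, blk_m y)}` (`C, δ ≥ 0`) satisfies
`Decays K (C·e^{δ}) (δ / (4(m+1)))` — rate `δ/(4·side)` per fine `ℓ¹`-step (`|x − y|₁ ≤ 4·dist x y ≤ 4((m+1)·dist_blk + m)`). -/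
theorem decays_of_blkBound {K : MKer 4 Unit} {C δ : ℝ} (m : ℕ) (hC : 0 ≤ C) (hδ : 0 ≤ δ)
    (hK : ∀ x y : X 4, |K x y () ()| ≤ C * Real.exp (-(δ * dist (blk m x) (blk m y)))) :
    Decays K (C * Real.exp δ) (δ / (4 * ((m : ℝ) + 1))) := by
  intro x y a b
  obtain ⟨⟩ := a; obtain ⟨⟩ := b
  refine (hK x y).trans ?_
  rw [mul_assoc, ← Real.exp_add]
  refine mul_le_mul_of_nonneg_left (Real.exp_le_exp.2 ?_) hC
  have h1 := l1_sub_le_four_mul_dist x y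
  have h2 := dist_le_side_mul_dist_blk m x y
  have hs : (0 : ℝ) < (m : ℝ) + 1 := by positivity
  have hD : l1 (x - y) / (4 * ((m : ℝ) + 1)) - 1 ≤ dist (blk m x) (blk m y) := by
    rw [sub_le_iff_le_add, div_le_iff₀ (by positivity)]
    have : (m : ℝ) ≤ (m : ℝ) + 1 := by linarith
    nlinarith
  have : δ * (l1 (x - y) / (4 * ((m : ℝ) + 1)) - 1) ≤ δ * dist (blk m x) (blk m y) := mul_le_mul_of_nonneg_left hD hδ
  have e : -(δ / (4 * ((m : ℝ) + 1))) * l1 (x - y) = -(δ * (l1 (x - y) / (4 * ((m : ℝ) + 1)) - 1)) - δ := by ring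
  rw [e]
  linarith

/-- [folklore] Rate monotonicity of `Decays` (nonnegative constant). -/
theorem decays_mono_rate {K : MKer 4 Unit} {C δ δ' : ℝ} (hK : Decays K C δ) (hC : 0 ≤ C) (h : δ' ≤ δ) :
    Decays K C δ' := fun x y a b =>
  (hK x y a b).trans (mul_le_mul_of_nonneg_left (Real.exp_le_exp.2 (by nlinarith [l1_nonneg (x - y)])) hC)

/-! ## §2 The road instance: `R = 1 − P` over J5.0's `Pgt`, and `Rjet n a Ṙ` -/

variable (n : ℕ) (a : ℝ)

/-- [folklore] **FINE `ℓ¹` DECAY OF THE PROJECTOR**: `Decays (Pgt n a) (c_PP·e^{δ_PP}) (δ_PP/(4n))` (blocks of side `n`; from J5.0's block-sup bound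
`abs_Pgt_le` by `decays_of_blkBound`). -/
theorem decays_Pgt [NeZero n] (ha : 0 < a) :
    Decays (Pgt n a) (cPP 4 (n - 1) a * Real.exp (deltaPP 4 a)) (deltaPP 4 a / (4 * (n : ℝ))) := by
  have h := decays_of_blkBound (K := Pgt n a) (n - 1) (cPP_nonneg 4 (n - 1) ha) (deltaPP_pos 4 ha).le
    (fun x y => abs_Pgt_le n ha x y () ())
  rwa [cast_pred_add_one n] at h

/-- [our object] **`R = 1 − P` IN THE ROAD'S CURRENCY**: `Rgt n a x y = [x = y] − Pgt n a x y` — the `U = 1` gauge-term projector of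
[Balaban1985BackgroundPropagators] (3.21)/(3.25) as typed by J5.0 (orientation only; a definition asserting nothing). -/
def Rgt : MKer 4 Unit := fun x y _ _ => (if x = y then (1 : ℝ) else 0) - Pgt n a x y () ()

/-- [our object] Unfolding `Rgt`. -/
theorem Rgt_apply (x y : Site 4) (u v : Unit) : Rgt n a x y u v = (if x = y then (1 : ℝ) else 0) - Pgt n a x y () () := rfl

/-- [folklore] `Rgt` is symmetric. -/
theorem Rgt_symm (ha : 0 < a) (x y : Site 4) : Rgt n a y x () () = Rgt n a x y () () := by
  rw [Rgt_apply, Rgt_apply, Pgt_symm n ha y x () (), if_congr (@eq_comm _ y x) rfl rfl]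

/-- [folklore] The identity kernel decays at any nonnegative rate with constant `1`. -/
theorem abs_ite_eq_le {δ : ℝ} (x y : Site 4) : |(if x = y then (1 : ℝ) else 0)| ≤ 1 * Real.exp (-δ * l1 (x - y)) := by
  by_cases h : x = y
  · rw [if_pos h, h, sub_self, show l1 (0 : Site 4) = 0 by simp [l1], mul_zero, Real.exp_zero, abs_one, mul_one]
  · rw [if_neg h, abs_zero, one_mul]; positivity

/-- [folklore] **FINE `ℓ¹` DECAY OF `R = 1 − P`**: `Decays (Rgt n a) (1 + c_PP·e^{δ_PP}) (δ_PP/(4n))`. -/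
theorem decays_Rgt [NeZero n] (ha : 0 < a) :
    Decays (Rgt n a) (1 + cPP 4 (n - 1) a * Real.exp (deltaPP 4 a)) (deltaPP 4 a / (4 * (n : ℝ))) := by
  intro x y u v
  have h1 := abs_ite_eq_le (δ := deltaPP 4 a / (4 * (n : ℝ))) x y
  have h2 := decays_Pgt n a ha x y () ()
  rw [Rgt_apply]
  calc |(if x = y then (1 : ℝ) else 0) - Pgt n a x y () ()| ≤ |(if x = y then (1 : ℝ) else 0)| + |Pgt n a x y () ()| := abs_sub _ _
    _ ≤ _ := add_le_add h1 h2
    _ = (1 + cPP 4 (n - 1) a * Real.exp (deltaPP 4 a)) * Real.exp (-(deltaPP 4 a / (4 * (n : ℝ))) * l1 (x - y)) := by ring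

/-- [folklore] The identity part of `Rgt` is shift-invariant; so `Rgt` is block-covariant whenever `Pgt` is. -/
theorem shiftK_Rgt_of_Pgt (w : Site 4) (hP : shiftK w (Pgt n a) = Pgt n a) : shiftK w (Rgt n a) = Rgt n a := by
  funext x y u v
  have h := congrFun (congrFun (congrFun (congrFun hP x) y) ()) ()
  simp only [shiftK] at h ⊢
  rw [Rgt_apply, Rgt_apply, h, if_congr (add_left_inj w) rfl rfl]

/-- [our object] **THE ROAD'S GAUGE-TERM JET** over J5.0's projector and a site jet `Ṙ`: `Rjet n a Ṙ κ′ u := RjetOf (Rgt n a) Ṙ κ′ u` — T4's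
`cR • Rjet` slot once `Ṙ := Ṙ n a` (J5-kernel) is supplied.  A definition asserting nothing. -/
def Rjet (Rd : Fin 4 → Site 4 → MKer 4 Unit) (κ' : Fin 4) (u : Site 4) : MKer 4 (Fin 4) := RjetOf (Rgt n a) Rd κ' u

/-- [our object] Unfolding `Rjet`. -/
theorem Rjet_eq (Rd : Fin 4 → Site 4 → MKer 4 Unit) (κ' : Fin 4) (u : Site 4) : Rjet n a Rd κ' u = RjetOf (Rgt n a) Rd κ' u := rfl

/-- [folklore] **LOCALISATION SOCKET** of the road's jet: for a site jet bi-localised at the bond at a rate `δ ≤ δ_PP/(4n)`,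
`BiLoc (Rjet n a Ṙ κ′ u) u u (4·(1 + c_PP e^{δ_PP} + C′)·e^{2δ}) δ` — the `δ/n`-class `locStencil` bound of the block-structured pieces (T4). -/
theorem biLoc_Rjet [NeZero n] (ha : 0 < a) {Rd : Fin 4 → Site 4 → MKer 4 Unit} {C' δ : ℝ} (κ' : Fin 4) (u : Site 4) (hδ0 : 0 ≤ δ)
    (hδ : δ ≤ deltaPP 4 a / (4 * (n : ℝ))) (hRd : BiLoc (Rd κ' u) u u C' δ) :
    BiLoc (Rjet n a Rd κ' u) u u (4 * ((1 + cPP 4 (n - 1) a * Real.exp (deltaPP 4 a)) + C') * Real.exp (2 * δ)) δ := by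
  have hC : 0 ≤ 1 + cPP 4 (n - 1) a * Real.exp (deltaPP 4 a) := by have := cPP_nonneg 4 (n - 1) ha; positivity
  exact biLoc_RjetOf κ' u hδ0 (decays_mono_rate (decays_Rgt n a ha) hC hδ) hRd

/-- [folklore] **TRANSPOSITION LAW** of the road's jet: for antisymmetric site jets it is antisymmetric (`Rgt` is symmetric). -/
theorem Rjet_antisymm (ha : 0 < a) {Rd : Fin 4 → Site 4 → MKer 4 Unit} (hRd : ∀ κ' u x z, Rd κ' u z x () () = -Rd κ' u x z () ())
    (κ' : Fin 4) (u x z : Site 4) (α β : Fin 4) : Rjet n a Rd κ' u z x β α = -Rjet n a Rd κ' u x z α β :=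
  RjetOf_antisymm κ' u (Rgt_symm n a ha) hRd x z α β

/-- [folklore] **BLOCK-TRANSLATION COVARIANCE** of the road's jet, GIVEN the block covariance of J5.0's `Pgt` (hypothesis `hP` — NOT proved in
J5.0 v1; the `Gk_translate` uniqueness pattern is expected to supply it) and of the site jet: `Rjet n a Ṙ κ′ (u + n•t) = shiftK (−n•t) (Rjet n a Ṙ κ′ u)`. -/
theorem Rjet_translate_of {Rd : Fin 4 → Site 4 → MKer 4 Unit} (t : Site 4) (hP : shiftK ((n : ℤ) • t) (Pgt n a) = Pgt n a)
    (hRd : ∀ κ' u, Rd κ' (u + (n : ℤ) • t) = shiftK (-((n : ℤ) • t)) (Rd κ' u)) (κ' : Fin 4) (u : Site 4) :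
    Rjet n a Rd κ' (u + (n : ℤ) • t) = shiftK (-((n : ℤ) • t)) (Rjet n a Rd κ' u) := by
  simp only [Rjet_eq]
  exact RjetOf_translate κ' u ((n : ℤ) • t) (shiftK_Rgt_of_Pgt n a _ hP) hRd


/-! ## §3 Block-translation covariance of J5.0's projector (the hypothesis `hP` DISCHARGED): `gq → kerSq → Csq → kerP → Pker → Pgt` -/

section Covariance

open B4Sect5Exhaustion (limInv eq_limInv_of_right_inverse)
open B6QGQLower276 (B mem_B gammaQ gammaQ_pos)
open B5Hk103ScalarZd (Gk gq toK)
open B6QGGQ278Zd (kerSq KerSq Csq cC deltaC cC_pos deltaC_pos abs_Csq_le summable_gq_mul_gq hyp56Z_KerSq cSq_pos deltaSq_pos)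
open GhostLeg (blk_translate Gk_translate side_pred)
open RProjector (kerP Pker summable_kerP summable_Pker tsum_kerSq_mul_Csq)

variable {a}

/-- [folklore] Blocks translate: `q ∈ B m (y + t) ↔ q − side m • t ∈ B m y`. -/
theorem mem_B_add_iff (m : ℕ) (y t q : X 4) : q ∈ B m (y + t) ↔ q - side m • t ∈ B m y := by
  have h := blk_translate m (q - side m • t) t
  rw [sub_add_cancel] at h
  rw [mem_B, mem_B, h]
  constructor
  · intro e; exact add_right_cancel e
  · intro e; rw [e]

/-- [folklore] **`G′Q′*` IS BLOCK-COVARIANT**: `gq m a (p + side m • t) (y + t) = gq m a p y` (from `GhostLeg.Gk_translate`). -/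
theorem gq_translate (m : ℕ) (ha : 0 < a) (t p y : X 4) : gq m a (p + side m • t) (y + t) = gq m a p y := by
  unfold gq
  have hinj : Set.InjOn (fun q : X 4 => q + side m • t) ↑(B m y) := fun q _ q' _ h => add_right_cancel h
  have himg : B m (y + t) = (B m y).image (fun q : X 4 => q + side m • t) := by
    ext q
    rw [Finset.mem_image, mem_B_add_iff]
    constructor
    · intro h; exact ⟨q - side m • t, h, sub_add_cancel q _⟩
    · rintro ⟨q', hq', rfl⟩; rwa [add_sub_cancel_right]
  rw [himg, Finset.sum_image hinj]
  exact Finset.sum_congr rfl fun q _ => Gk_translate a m ha t p q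

/-- [folklore] **`Q′G′²Q′*` IS TRANSLATION-INVARIANT** on the unit lattice: `kerSq m a (y + t) (y′ + t) = kerSq m a y y′`. -/
theorem kerSq_translate (m : ℕ) (ha : 0 < a) (t y y' : X 4) : kerSq m a (y + t) (y' + t) = kerSq m a y y' := by
  unfold kerSq
  congr 1
  rw [← (Equiv.addRight (side m • t)).tsum_eq (fun r => gq m a r (y + t) * gq m a r (y' + t))]
  exact tsum_congr fun r => by simp only [Equiv.coe_addRight, gq_translate m ha]

/-- [folklore] **«THE OPERATOR C» IS TRANSLATION-INVARIANT**: `Csq m a (y + t) (y′ + t) = Csq m a y y′` — the translated kernel is again a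
bounded two-sided inverse of the translation-invariant `Q′G′²Q′*`, and the bounded inverse on `ℤ⁴` is unique
(`B4Sect5Exhaustion.eq_limInv_of_right_inverse`; the pattern of `GhostLeg.Gk_translate`). -/
theorem Csq_translate (m : ℕ) (ha : 0 < a) (t y y' : X 4) : Csq m a (y + t) (y' + t) = Csq m a y y' := by
  have hγ : 0 < gammaQ 4 a ^ 2 := pow_pos (gammaQ_pos 4 ha) 2
  have hbd : ∀ p' q' : B4Sect5Exhaustion.K 4 1, |Csq m a (p'.1 + t) (q'.1 + t)| ≤ cC 4 a := fun p' q' => by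
    refine (abs_Csq_le m ha _ _).trans (mul_le_of_le_one_right (cC_pos 4 ha).le ?_)
    rw [Real.exp_le_one_iff, neg_nonpos]
    have := deltaC_pos 4 ha
    positivity
  have hinv : ∀ p' r' : B4Sect5Exhaustion.K 4 1, p'.1 ∈ (Set.univ : Set (X 4)) → r'.1 ∈ (Set.univ : Set (X 4)) →
      ∑' q' : B4Sect5Exhaustion.K 4 1, KerSq m a p' q' * Csq m a (q'.1 + t) (r'.1 + t) = if p' = r' then 1 else 0 := by
    intro p' r' _ _
    have h1 : ∑' q' : B4Sect5Exhaustion.K 4 1, KerSq m a p' q' * Csq m a (q'.1 + t) (r'.1 + t)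
        = ∑' w : X 4, kerSq m a p'.1 w * Csq m a (w + t) (r'.1 + t) := by
      rw [← Equiv.tsum_eq (toK (d := 4))]
      rfl
    have h2 : ∀ w : X 4, kerSq m a p'.1 w * Csq m a (w + t) (r'.1 + t)
        = kerSq m a (p'.1 + t) (w + t) * Csq m a (w + t) (r'.1 + t) := fun w => by rw [kerSq_translate m ha]
    have h3 : ∑' w : X 4, kerSq m a (p'.1 + t) (w + t) * Csq m a (w + t) (r'.1 + t)
        = ∑' w' : X 4, kerSq m a (p'.1 + t) w' * Csq m a w' (r'.1 + t) :=
      (Equiv.addRight t).tsum_eq (fun w' => kerSq m a (p'.1 + t) w' * Csq m a w' (r'.1 + t))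
    rw [h1, tsum_congr h2, h3, tsum_kerSq_mul_Csq m ha]
    have hiff : p'.1 + t = r'.1 + t ↔ p' = r' := by
      rw [add_left_inj]
      exact ⟨fun h => Prod.ext h (Subsingleton.elim _ _), fun h => by rw [h]⟩
    simp only [hiff]
  exact eq_limInv_of_right_inverse hγ (cSq_pos 4 ha) (deltaSq_pos 4 ha) (hyp56Z_KerSq (d := 4) m ha)
    (D := fun p' q' : B4Sect5Exhaustion.K 4 1 => Csq m a (p'.1 + t) (q'.1 + t)) (M := cC 4 a) hbd
    (fun p' q' h => absurd (Set.mem_univ _) h) hinv (p := (y, 0)) (s := (y', 0)) (Set.mem_univ _) (Set.mem_univ _)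

/-- [folklore] `G′Q′*C` is block-covariant: `kerP m a (p + side m • t) (y + t) = kerP m a p y`. -/
theorem kerP_translate (m : ℕ) (ha : 0 < a) (t p y : X 4) : kerP m a (p + side m • t) (y + t) = kerP m a p y := by
  unfold kerP
  rw [← (Equiv.addRight t).tsum_eq (fun w => gq m a (p + side m • t) w * Csq m a w (y + t))]
  exact tsum_congr fun w => by simp only [Equiv.coe_addRight, gq_translate m ha, Csq_translate m ha]

/-- [folklore] **THE PROJECTOR IS BLOCK-COVARIANT**: `Pker m a (p + side m • t) (q + side m • t) = Pker m a p q`. -/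
theorem Pker_translate (m : ℕ) (ha : 0 < a) (t p q : X 4) :
    Pker m a (p + side m • t) (q + side m • t) = Pker m a p q := by
  unfold Pker
  congr 1
  rw [← (Equiv.addRight t).tsum_eq (fun w => kerP m a (p + side m • t) w * gq m a (q + side m • t) w)]
  exact tsum_congr fun w => by simp only [Equiv.coe_addRight, kerP_translate m ha, gq_translate m ha]

/-- [folklore] **`shiftK (n • t) (Pgt n a) = Pgt n a`** — the block covariance of J5.0's projector in the road's currency (block side `n`):
the `hP` of `Rjet_translate_of` is a THEOREM. -/
theorem shiftK_Pgt [NeZero n] (ha : 0 < a) (t : Site 4) : shiftK ((n : ℤ) • t) (Pgt n a) = Pgt n a := by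
  funext x y u v
  simp only [shiftK, Pgt_apply]
  have h := Pker_translate (n - 1) ha t x y
  rwa [side_pred] at h

/-- [folklore] Hence `R = 1 − P` is block-covariant. -/
theorem shiftK_Rgt [NeZero n] (ha : 0 < a) (t : Site 4) : shiftK ((n : ℤ) • t) (Rgt n a) = Rgt n a :=
  shiftK_Rgt_of_Pgt n a _ (shiftK_Pgt n ha t)

/-- [folklore] **BLOCK-TRANSLATION COVARIANCE OF THE ROAD'S JET**, unconditional in `P`: for a block-covariant site jet `Ṙ`,
`Rjet n a Ṙ κ′ (u + n•t) = shiftK (−n•t) (Rjet n a Ṙ κ′ u)` — the (St♭) socket T4's `Sbf_translate` asks of its `cR • Rjet` summand. -/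
theorem Rjet_translate [NeZero n] (ha : 0 < a) {Rd : Fin 4 → Site 4 → MKer 4 Unit} (t : Site 4)
    (hRd : ∀ κ' u, Rd κ' (u + (n : ℤ) • t) = shiftK (-((n : ℤ) • t)) (Rd κ' u)) (κ' : Fin 4) (u : Site 4) :
    Rjet n a Rd κ' (u + (n : ℤ) • t) = shiftK (-((n : ℤ) • t)) (Rjet n a Rd κ' u) :=
  Rjet_translate_of n a t (shiftK_Pgt n ha t) hRd κ' u

end Covariance

end

end Summit.QuantumFields.BalabanUV.Beta.D1BFx.RJetProjector
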